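import Literature.AlgebraicGeometry.Motives.HodgeLieDirectSum
import HarnessLib

/-!
# The centre and the derived algebra of `𝔥(⊕_j H_j)` embed in the products: `dim 𝔷(⊕_j H_j) ≤ Σ_j dim 𝔷(H_j)`,
# `dim [𝔥, 𝔥](⊕_j H_j) ≤ Σ_j dim [𝔥, 𝔥](H_j)` (the centre and the semisimple part of `Hg(X₁ × X₂) ⊆ Hg(X₁) × Hg(X₂)`)

Family `hodge`, layer `Literature/AlgebraicGeometry/Motives`; THEOREMS ONLY (no definition, no named fact; net debt 0).
Written for the cell `pub-hodgecm2` (COR-CM), seat `b27` gen 43 (count-neutral Mumford–Tate-rank ladder).  Refinement of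
`Motives/HodgeLieDirectSum` §3 (gen 35: `dim 𝔥(⊕_j H_j) ≤ Σ_j dim 𝔥(H_j)`, the Lie form of «`Hg(X₁ × X₂) ⊆ Hg(X₁) × Hg(X₂)`»,
Moonen–Zarhin 1999 §3 first paragraph): the block map `X ↦ (pr_j X in_j)_j` is injective on `𝔥(⊕ H_j)` (its elements are
block diagonal) and maps
* the centre `𝔷 = 𝔥 ∩ End_Hdg` into `Π_j 𝔷(H_j)` (a diagonal block of a Hodge endomorphism is a Hodge endomorphism), and
* the derived algebra `𝔡 = span {XY − YX}` into `Π_j 𝔡(H_j)` (the block map is multiplicative on block-diagonal operators: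
  `pr_j (XY) in_j = (pr_j X in_j)(pr_j Y in_j)`),
so that **`finrank_hodgeLie_inf_endAlg_pi_le_sum`**: `dim_ℚ 𝔷(⊕_j H_j) ≤ Σ_j dim_ℚ 𝔷(H_j)` and
**`finrank_hodgeLie_derived_pi_le_sum`**: `dim_ℚ 𝔡(⊕_j H_j) ≤ Σ_j dim_ℚ 𝔡(H_j)`.  For complex abelian varieties: the type-IV
(central) part and the semisimple part of `Hg(X₁ × ⋯ × X_r)` have dimension at most the sum over the factors; e.g. a
product of varieties with semisimple Hodge groups (`𝔷 = 0`) has semisimple Hodge group.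

## References
* [MoonenZarhin1999LowDim] B. Moonen, Yu. Zarhin, Math. Ann. 315 (1999), §3 first paragraph and (3.1)
  [corpus: paper:arxiv-math_9901113 p. 6]. [cite: MoonenZarhin1999LowDim, §3]
* [Deligne1982HodgeCycles] P. Deligne, LNM 900 (1982), I §3.1, Prop. 3.4 and Prop. 3.6. [cite: Deligne1982HodgeCycles, I §3 Prop. 3.6]
* [Huybrechts2016K3] D. Huybrechts, *Lectures on K3 Surfaces*, §3.3.3 (`End_Hdg`). [cite: Huybrechts2016K3, §3.3.3]
-/

noncomputable section

namespace Literature.AlgebraicGeometry.Motives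

namespace HodgeStructure

universe u

variable {ι : Type} [Fintype ι] [DecidableEq ι] {W : ι → Type u} [∀ j, AddCommGroup (W j)] [∀ j, Module ℚ (W j)]
  [∀ j, Module.Finite ℚ (W j)] [HodgeTensorFacts.{u, u}] {n : ℤ} (H : ∀ j, HodgeStructure (W j) n)

omit [∀ j, Module.Finite ℚ (W j)] [HodgeTensorFacts.{u, u}] in
/-- **A diagonal block of a Hodge endomorphism of `⊕_j H_j` is a Hodge endomorphism of `H_j`** (`pr_j ∘ a ∘ in_j` is a composite
of morphisms). [cite: Huybrechts2016K3, §3.3.3] -/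
theorem proj_comp_single_mem_endAlg_pi (j : ι) {a : Module.End ℚ (∀ i, W i)} (ha : a ∈ (pi H).endAlg) :
    LinearMap.proj j ∘ₗ a ∘ₗ LinearMap.single ℚ W j ∈ (H j).endAlg :=
  Hom.toLinearMap_mem_endAlg
    ((Hom.piProj H j).comp ((endAlg.toHom ⟨a, ha⟩).comp
      ({ toLinearMap := LinearMap.single ℚ W j, map_F_le := single_map_pi_F_le H j } : Hom (H j) (pi H))))

/-- **The block map is multiplicative on `𝔥(⊕_j H_j)`**: `pr_j (X Y) in_j = (pr_j X in_j) (pr_j Y in_j)` for `Y ∈ 𝔥(⊕ H_j)` (the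
off-diagonal blocks of `Y` vanish, `proj_comp_single_eq_zero_of_mem_hodgeLie_pi`). [cite: MoonenZarhin1999LowDim, §3]
[cite: Deligne1982HodgeCycles, I §3 Prop. 3.6] -/
theorem proj_comp_mul_comp_single_of_mem_hodgeLie_pi (j : ι) (X : Module.End ℚ (∀ i, W i)) {Y : Module.End ℚ (∀ i, W i)}
    (hY : Y ∈ (pi H).hodgeLie) :
    LinearMap.proj j ∘ₗ (X * Y) ∘ₗ LinearMap.single ℚ W j =
      (LinearMap.proj j ∘ₗ X ∘ₗ LinearMap.single ℚ W j) * (LinearMap.proj j ∘ₗ Y ∘ₗ LinearMap.single ℚ W j) := by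
  refine LinearMap.ext fun u => ?_
  -- `Y (single_j u) = single_j ((Y single_j u) j)` since the off-diagonal blocks of `Y` vanish
  have hYs : Y (Pi.single j u) = Pi.single j ((Y (Pi.single j u)) j) := by
    funext i
    by_cases h : i = j
    · subst h; rw [Pi.single_eq_same]
    · rw [Pi.single_eq_of_ne h]
      have := LinearMap.congr_fun (proj_comp_single_eq_zero_of_mem_hodgeLie_pi H h hY) u
      simpa only [LinearMap.comp_apply, LinearMap.coe_single, LinearMap.proj_apply, LinearMap.zero_apply] using this
  simp only [LinearMap.comp_apply, Module.End.mul_apply, LinearMap.coe_single, LinearMap.proj_apply]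
  conv_lhs => rw [hYs]

/-- **`dim_ℚ 𝔷(⊕_j H_j) ≤ Σ_j dim_ℚ 𝔷(H_j)`** for the centre `𝔷 = 𝔥 ∩ End_Hdg`: the block map `Z ↦ (pr_j Z in_j)_j` sends `𝔷(⊕ H_j)`
into `Π_j 𝔷(H_j)` injectively.  For abelian varieties: the central (type-IV) part of `Hg(X₁ × ⋯ × X_r)` has dimension at most
`Σ dim 𝔷(X_i)`; a product of varieties with `𝔷 = 0` has `𝔷 = 0`. [cite: MoonenZarhin1999LowDim, §3]
[cite: Deligne1982HodgeCycles, I §3 Prop. 3.6] -/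
theorem finrank_hodgeLie_inf_endAlg_pi_le_sum :
    Module.finrank ℚ ↥((pi H).hodgeLie ⊓ Subalgebra.toSubmodule (pi H).endAlg) ≤
      ∑ j, Module.finrank ℚ ↥((H j).hodgeLie ⊓ Subalgebra.toSubmodule (H j).endAlg) := by
  classical
  let Φ : ↥((pi H).hodgeLie ⊓ Subalgebra.toSubmodule (pi H).endAlg) →ₗ[ℚ]
      (∀ j, ↥((H j).hodgeLie ⊓ Subalgebra.toSubmodule (H j).endAlg)) :=
    { toFun := fun X j => ⟨LinearMap.proj j ∘ₗ (X : Module.End ℚ (∀ i, W i)) ∘ₗ LinearMap.single ℚ W j,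
        Submodule.mem_inf.2 ⟨proj_comp_single_mem_hodgeLie_pi H j (Submodule.mem_inf.1 X.2).1,
          (Subalgebra.mem_toSubmodule _).2
            (proj_comp_single_mem_endAlg_pi H j ((Subalgebra.mem_toSubmodule _).1 (Submodule.mem_inf.1 X.2).2))⟩⟩
      map_add' := fun X Y => funext fun j => Subtype.ext (by
        simp only [Submodule.coe_add, LinearMap.comp_add, LinearMap.add_comp, Pi.add_apply])
      map_smul' := fun c X => funext fun j => Subtype.ext (by
        simp only [Submodule.coe_smul, LinearMap.comp_smul, LinearMap.smul_comp, RingHom.id_apply, Pi.smul_apply]) }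
  have hΦ : Function.Injective Φ := by
    rw [injective_iff_map_eq_zero]
    intro X hX0
    refine Subtype.ext (eq_zero_of_forall_proj_comp_single_eq_zero H (Submodule.mem_inf.1 X.2).1 fun j => ?_)
    exact congrArg (fun F => ((F j : ↥((H j).hodgeLie ⊓ Subalgebra.toSubmodule (H j).endAlg)) : Module.End ℚ (W j))) hX0
  calc Module.finrank ℚ ↥((pi H).hodgeLie ⊓ Subalgebra.toSubmodule (pi H).endAlg)
        ≤ Module.finrank ℚ (∀ j, ↥((H j).hodgeLie ⊓ Subalgebra.toSubmodule (H j).endAlg)) :=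
          LinearMap.finrank_le_finrank_of_injective hΦ
    _ = ∑ j, Module.finrank ℚ ↥((H j).hodgeLie ⊓ Subalgebra.toSubmodule (H j).endAlg) := Module.finrank_pi_fintype ℚ

/-- **`dim_ℚ [𝔥, 𝔥](⊕_j H_j) ≤ Σ_j dim_ℚ [𝔥, 𝔥](H_j)`** for the derived algebras: the block map sends the span of the commutators of
`𝔥(⊕ H_j)` into the product of the spans of the commutators of the `𝔥(H_j)` (it is multiplicative on block-diagonal operators
and maps `𝔥(⊕ H_j)` into `𝔥(H_j)`), injectively.  For abelian varieties: the semisimple part of `Hg(X₁ × ⋯ × X_r)` has dimension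
at most `Σ dim [Lie Hg, Lie Hg](H¹X_i)`. [cite: MoonenZarhin1999LowDim, §3] [cite: Deligne1982HodgeCycles, I §3 Prop. 3.6] -/
theorem finrank_hodgeLie_derived_pi_le_sum :
    Module.finrank ℚ ↥(Submodule.span ℚ {B | ∃ X ∈ (pi H).hodgeLie, ∃ Y ∈ (pi H).hodgeLie, X * Y - Y * X = B}) ≤
      ∑ j, Module.finrank ℚ ↥(Submodule.span ℚ {B | ∃ X ∈ (H j).hodgeLie, ∃ Y ∈ (H j).hodgeLie, X * Y - Y * X = B}) := by
  classical
  -- the block map at `j` as a linear map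
  let r : ∀ j : ι, Module.End ℚ (∀ i, W i) →ₗ[ℚ] Module.End ℚ (W j) := fun j =>
    (LinearMap.llcomp ℚ (W j) (∀ i, W i) (W j) (LinearMap.proj j)).comp (LinearMap.lcomp ℚ (∀ i, W i) (LinearMap.single ℚ W j))
  have hr : ∀ j (X : Module.End ℚ (∀ i, W i)), r j X = LinearMap.proj j ∘ₗ X ∘ₗ LinearMap.single ℚ W j := fun _ _ => rfl
  -- the derived algebra of the sum is inside `𝔥(⊕ H)` and maps into the derived algebras of the summands
  have hDle : Submodule.span ℚ {B | ∃ X ∈ (pi H).hodgeLie, ∃ Y ∈ (pi H).hodgeLie, X * Y - Y * X = B} ≤ (pi H).hodgeLie :=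
    Submodule.span_le.2 (by
      rintro _ ⟨X, hX, Y, hY, rfl⟩
      exact (pi H).commutator_mem_hodgeLie hX hY)
  have hmap : ∀ j, (Submodule.span ℚ {B | ∃ X ∈ (pi H).hodgeLie, ∃ Y ∈ (pi H).hodgeLie, X * Y - Y * X = B}).map (r j) ≤
      Submodule.span ℚ {B | ∃ X ∈ (H j).hodgeLie, ∃ Y ∈ (H j).hodgeLie, X * Y - Y * X = B} := by
    intro j
    rw [Submodule.map_span, Submodule.span_le]
    rintro _ ⟨_, ⟨X, hX, Y, hY, rfl⟩, rfl⟩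
    refine Submodule.subset_span ⟨r j X, ?_, r j Y, ?_, ?_⟩
    · rw [hr]; exact proj_comp_single_mem_hodgeLie_pi H j hX
    · rw [hr]; exact proj_comp_single_mem_hodgeLie_pi H j hY
    · rw [hr, hr, hr, LinearMap.sub_comp, LinearMap.comp_sub, proj_comp_mul_comp_single_of_mem_hodgeLie_pi H j X hY,
        proj_comp_mul_comp_single_of_mem_hodgeLie_pi H j Y hX]
  let Φ : ↥(Submodule.span ℚ {B | ∃ X ∈ (pi H).hodgeLie, ∃ Y ∈ (pi H).hodgeLie, X * Y - Y * X = B}) →ₗ[ℚ]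
      (∀ j, ↥(Submodule.span ℚ {B | ∃ X ∈ (H j).hodgeLie, ∃ Y ∈ (H j).hodgeLie, X * Y - Y * X = B})) :=
    { toFun := fun D j => ⟨r j (D : Module.End ℚ (∀ i, W i)), hmap j ⟨D, D.2, rfl⟩⟩
      map_add' := fun D D' => funext fun j => Subtype.ext (by
        simp only [Submodule.coe_add, map_add, Pi.add_apply])
      map_smul' := fun c D => funext fun j => Subtype.ext (by
        simp only [Submodule.coe_smul, map_smul, RingHom.id_apply, Pi.smul_apply]) }
  have hΦ : Function.Injective Φ := by
    rw [injective_iff_map_eq_zero]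
    intro D hD0
    refine Subtype.ext (eq_zero_of_forall_proj_comp_single_eq_zero H (hDle D.2) fun j => ?_)
    have h := congrArg (fun F => ((F j : ↥(Submodule.span ℚ {B | ∃ X ∈ (H j).hodgeLie, ∃ Y ∈ (H j).hodgeLie,
      X * Y - Y * X = B})) : Module.End ℚ (W j))) hD0
    rw [← hr]; exact h
  calc Module.finrank ℚ ↥(Submodule.span ℚ {B | ∃ X ∈ (pi H).hodgeLie, ∃ Y ∈ (pi H).hodgeLie, X * Y - Y * X = B})
        ≤ Module.finrank ℚ (∀ j, ↥(Submodule.span ℚ {B | ∃ X ∈ (H j).hodgeLie, ∃ Y ∈ (H j).hodgeLie, X * Y - Y * X = B})) :=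
          LinearMap.finrank_le_finrank_of_injective hΦ
    _ = ∑ j, Module.finrank ℚ ↥(Submodule.span ℚ {B | ∃ X ∈ (H j).hodgeLie, ∃ Y ∈ (H j).hodgeLie, X * Y - Y * X = B}) :=
          Module.finrank_pi_fintype ℚ

end HodgeStructure

end Literature.AlgebraicGeometry.Motives

end
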